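import Literature.AlgebraicGeometry.Hu2025.Proofs.S03Pluecker.Prop36
import Literature.AlgebraicGeometry.Hu2025.Proofs.S03Pluecker.KeyTrick
import HarnessLib

/-!
# Hu 2025 §3.3 — DISCHARGE of `C18L166` (ideal reading): every de-homogenised Plücker relation lies in `(𝓕_m)` on the chart, i.e.
# `I_{℘,m} ⊆ (𝓕_m)` — via `Prop3_6_1_holds` (`(𝓕_m) = ker chartParam`) and the Grassmann–Plücker identity for the `3 × 3` minors of `[I₃ | A]`
# (row 101b, typer res-type-009)

**HONEST FRAMING (D-0012/D-0089).** A theorem about OUR typed transcription `C18L166` (chunk p0018 l.164–171 read as ideal membership, the reading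
the paper's own Ex 3.9 illustrates); the preprint [Hu2025] stays «under review». The mathematical input is classical: the maximal minors of any
`3 × n` matrix satisfy the quadratic Plücker relations (here a `ring` identity in 18 entries, `gp_identity`). AI proof, weaker than expert review;
nothing here is progress on resolution of singularities.

Contents: `minorOf a b c` (the `3 × 3` minor of `[I₃ | A]` on ARBITRARY columns) and its alternation; `chartParam (dehomog p_{abc}) = minorOf a b c`
for all `a, b, c ∈ [n]` (`chartParam_dehomog_pCoord`); the Grassmann–Plücker identity; `chartParam (dehomog F_{h,k}) = 0`; `C18L166_holds`.
-/

noncomputable section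

namespace Literature.AlgebraicGeometry.Hu2025.Statements.S03Pluecker

open MvPolynomial

universe u

variable {n : ℕ} (k : Type u) [CommRing k]

/-! ## §1 Minors of `[I₃ | A]` on arbitrary columns -/

/-- The `3 × 3` minor of `[I₃ | A]` on the columns `a, b, c` IN THIS ORDER (rows of the matrix = the three columns; `det Mᵀ = det M`).
`chartMinor k (a,b,c) = minorOf k a b c` by `rfl`.
[cite: Hu2025, §3c closing question (C18L166), p.39 l.30–34; Ex. 3.9 p.40 (unrefereed preprint arXiv:2507.21400v1 under adjudication, D-0012/D-0089
— kernel support on OUR typed carriers of row 101; nothing of the source asserted)] -/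
def minorOf (a b c : ℕ) : BasicRing n k :=
  Matrix.det (Matrix.of ![chartCol k a, chartCol k b, chartCol k c])

/-- `chartMinor` is `minorOf` on the triple.
[cite: Hu2025, §3c closing question (C18L166), p.39 l.30–34; Ex. 3.9 p.40 (unrefereed preprint arXiv:2507.21400v1 under adjudication, D-0012/D-0089
— kernel support on OUR typed carriers of row 101; nothing of the source asserted)] -/
theorem chartMinor_eq_minorOf (t : ℕ × ℕ × ℕ) : (chartMinor k t : BasicRing n k) = minorOf k t.1 t.2.1 t.2.2 := rfl

/-- `minorOf 1 2 3 = det I₃ = 1`.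
[cite: Hu2025, §3c closing question (C18L166), p.39 l.30–34; Ex. 3.9 p.40 (unrefereed preprint arXiv:2507.21400v1 under adjudication, D-0012/D-0089
— kernel support on OUR typed carriers of row 101; nothing of the source asserted)] -/
theorem minorOf_one_two_three : (minorOf k 1 2 3 : BasicRing n k) = 1 := by
  unfold minorOf
  rw [chartCol_one, chartCol_two, chartCol_three, Matrix.det_fin_three]
  simp [Matrix.of_apply]

/-- Alternation: swapping the last two columns changes the sign.
[cite: Hu2025, §3c closing question (C18L166), p.39 l.30–34; Ex. 3.9 p.40 (unrefereed preprint arXiv:2507.21400v1 under adjudication, D-0012/D-0089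
— kernel support on OUR typed carriers of row 101; nothing of the source asserted)] -/
theorem minorOf_swap23 (a b c : ℕ) : (minorOf k a c b : BasicRing n k) = -minorOf k a b c := by
  unfold minorOf; rw [Matrix.det_fin_three, Matrix.det_fin_three]; simp [Matrix.of_apply]; ring

/-- Alternation: swapping the first two columns changes the sign.
[cite: Hu2025, §3c closing question (C18L166), p.39 l.30–34; Ex. 3.9 p.40 (unrefereed preprint arXiv:2507.21400v1 under adjudication, D-0012/D-0089
— kernel support on OUR typed carriers of row 101; nothing of the source asserted)] -/
theorem minorOf_swap12 (a b c : ℕ) : (minorOf k b a c : BasicRing n k) = -minorOf k a b c := by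
  unfold minorOf; rw [Matrix.det_fin_three, Matrix.det_fin_three]; simp [Matrix.of_apply]; ring

/-- Alternation: swapping the outer columns changes the sign.
[cite: Hu2025, §3c closing question (C18L166), p.39 l.30–34; Ex. 3.9 p.40 (unrefereed preprint arXiv:2507.21400v1 under adjudication, D-0012/D-0089
— kernel support on OUR typed carriers of row 101; nothing of the source asserted)] -/
theorem minorOf_swap13 (a b c : ℕ) : (minorOf k c b a : BasicRing n k) = -minorOf k a b c := by
  unfold minorOf; rw [Matrix.det_fin_three, Matrix.det_fin_three]; simp [Matrix.of_apply]; ring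

/-- A repeated column kills the minor (`aab`).
[cite: Hu2025, §3c closing question (C18L166), p.39 l.30–34; Ex. 3.9 p.40 (unrefereed preprint arXiv:2507.21400v1 under adjudication, D-0012/D-0089
— kernel support on OUR typed carriers of row 101; nothing of the source asserted)] -/
theorem minorOf_aab (a b : ℕ) : (minorOf k a a b : BasicRing n k) = 0 := by
  unfold minorOf; rw [Matrix.det_fin_three]; simp [Matrix.of_apply]; ring

/-- A repeated column kills the minor (`aba`).
[cite: Hu2025, §3c closing question (C18L166), p.39 l.30–34; Ex. 3.9 p.40 (unrefereed preprint arXiv:2507.21400v1 under adjudication, D-0012/D-0089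
— kernel support on OUR typed carriers of row 101; nothing of the source asserted)] -/
theorem minorOf_aba (a b : ℕ) : (minorOf k a b a : BasicRing n k) = 0 := by
  unfold minorOf; rw [Matrix.det_fin_three]; simp [Matrix.of_apply]; ring

/-- A repeated column kills the minor (`baa`).
[cite: Hu2025, §3c closing question (C18L166), p.39 l.30–34; Ex. 3.9 p.40 (unrefereed preprint arXiv:2507.21400v1 under adjudication, D-0012/D-0089
— kernel support on OUR typed carriers of row 101; nothing of the source asserted)] -/
theorem minorOf_baa (a b : ℕ) : (minorOf k b a a : BasicRing n k) = 0 := by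
  unfold minorOf; rw [Matrix.det_fin_three]; simp [Matrix.of_apply]; ring

/-! ## §2 `chartParam ∘ dehomog` on the signed coordinates -/

/-- `chartParam (dehomog p_t) = minorOf` for an increasing triple `t` in `[n]` (at `t = m`: `x̄_m = 1 = det I₃`).
[cite: Hu2025, §3c closing question (C18L166), p.39 l.30–34; Ex. 3.9 p.40 (unrefereed preprint arXiv:2507.21400v1 under adjudication, D-0012/D-0089
— kernel support on OUR typed carriers of row 101; nothing of the source asserted)] -/
theorem chartParam_dehomog_pTri {a b c : ℕ} (ha : 1 ≤ a) (hab : a < b) (hbc : b < c) (hc : c ≤ n) :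
    chartParam n k (dehomog n k (pTri k (a, b, c))) = minorOf k a b c := by
  have ht : (a, b, c) ∈ plIndexSet n := mem_plIndexSet ha hab hbc hc
  unfold pTri
  rw [dif_pos ht]
  unfold dehomog
  rw [aeval_X]
  change chartParam n k (xbar k (a, b, c)) = _
  by_cases h3 : 3 < c
  · rw [chartParam_xbar k (mem_plVarSet ha hab hbc hc h3), chartMinor_eq_minorOf]
  · obtain ⟨rfl, rfl, rfl⟩ : a = 1 ∧ b = 2 ∧ c = 3 := by omega
    rw [show (((1 : ℕ), (2 : ℕ), (3 : ℕ)) : ℕ × ℕ × ℕ) = mTri from rfl, chartParam_xbar_mTri, minorOf_one_two_three]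

/-- **`chartParam (dehomog p_{abc}) = minorOf a b c` for ALL `a, b, c ∈ [n]`** (the signed lookup's sign is the alternation of the determinant;
repeated indices give `0` on both sides).
[cite: Hu2025, §3c closing question (C18L166), p.39 l.30–34; Ex. 3.9 p.40 (unrefereed preprint arXiv:2507.21400v1 under adjudication, D-0012/D-0089
— kernel support on OUR typed carriers of row 101; nothing of the source asserted)] -/
theorem chartParam_dehomog_pCoord {a b c : ℕ} (ha : 1 ≤ a ∧ a ≤ n) (hb : 1 ≤ b ∧ b ≤ n) (hc : 1 ≤ c ∧ c ≤ n) :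
    chartParam n k (dehomog n k (pCoord k a b c)) = minorOf k a b c := by
  -- repeated indices
  by_cases eab : a = b
  · subst eab; rw [pCoord_aab, map_zero, map_zero, minorOf_aab]
  by_cases eac : a = c
  · subst eac; rw [pCoord_aba, map_zero, map_zero, minorOf_aba]
  by_cases ebc : b = c
  · subst ebc; rw [pCoord_baa, map_zero, map_zero, minorOf_baa]
  -- six orderings
  rcases Nat.lt_or_gt_of_ne eab with hab | hab <;> rcases Nat.lt_or_gt_of_ne ebc with hbc | hbc <;>
    rcases Nat.lt_or_gt_of_ne eac with hac | hac
  · -- a < b < c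
    rw [pCoord_abc k hab hbc, chartParam_dehomog_pTri k ha.1 hab hbc hc.2]
  · omega
  · -- a < b, c < b, a < c : (a,c,b) sorted = (a,c,b); given as pCoord a b c with order a < c < b
    rw [pCoord_acb k (a := a) (b := c) (c := b) hac hbc, map_neg, map_neg, chartParam_dehomog_pTri k ha.1 hac hbc hb.2, ← minorOf_swap23]
  · -- a < b, c < b, c < a : sorted (c,a,b)
    rw [pCoord_bca k (a := c) (b := a) (c := b) hac hab, chartParam_dehomog_pTri k hc.1 hac hab hb.2, minorOf_swap12 k a c b,
      minorOf_swap23 k a b c, neg_neg]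
  · -- b < a, b < c, a < c : sorted (b,a,c)
    rw [pCoord_bac k (a := b) (b := a) (c := c) hab hac, map_neg, map_neg, chartParam_dehomog_pTri k hb.1 hab hac hc.2, ← minorOf_swap12]
  · -- b < a, b < c, c < a : sorted (b,c,a)
    rw [pCoord_cab k (a := b) (b := c) (c := a) hbc hac, chartParam_dehomog_pTri k hb.1 hbc hac ha.2, minorOf_swap23 k b a c,
      minorOf_swap12 k a b c, neg_neg]
  · omega
  · -- b < a, c < b, c < a : sorted (c,b,a)
    rw [pCoord_cba k (a := c) (b := b) (c := a) hbc hab, map_neg, map_neg, chartParam_dehomog_pTri k hc.1 hbc hab ha.2, ← minorOf_swap13]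

/-! ## §3 The Grassmann–Plücker identity and the discharge -/

/-- **Grassmann–Plücker identity** for the `3 × 3` minors of a `3 × n` matrix (here `[I₃ | A]`, but the proof is the polynomial identity in the
`18` entries of six columns): `M_{h₁h₂k₁}M_{k₂k₃k₄} − M_{h₁h₂k₂}M_{k₁k₃k₄} + M_{h₁h₂k₃}M_{k₁k₂k₄} − M_{h₁h₂k₄}M_{k₁k₂k₃} = 0`.
[cite: Hu2025, §3c closing question (C18L166), p.39 l.30–34; Ex. 3.9 p.40 (unrefereed preprint arXiv:2507.21400v1 under adjudication, D-0012/D-0089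
— kernel support on OUR typed carriers of row 101; nothing of the source asserted)] -/
theorem gp_identity (h₁ h₂ k₁ k₂ k₃ k₄ : ℕ) :
    (minorOf k h₁ h₂ k₁ * minorOf k k₂ k₃ k₄ - minorOf k h₁ h₂ k₂ * minorOf k k₁ k₃ k₄
      + minorOf k h₁ h₂ k₃ * minorOf k k₁ k₂ k₄ - minorOf k h₁ h₂ k₄ * minorOf k k₁ k₂ k₃ : BasicRing n k) = 0 := by
  unfold minorOf
  simp [Matrix.det_fin_three, Matrix.of_apply]
  ring

/-- **`chartParam (dehomog F_{h,k}) = 0`** for all indices in `[n]`: the minors of `[I₃ | A]` satisfy every Plücker relation.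
[cite: Hu2025, §3c closing question (C18L166), p.39 l.30–34; Ex. 3.9 p.40 (unrefereed preprint arXiv:2507.21400v1 under adjudication, D-0012/D-0089
— kernel support on OUR typed carriers of row 101; nothing of the source asserted)] -/
theorem chartParam_dehomog_plRel {h₁ h₂ k₁ k₂ k₃ k₄ : ℕ} (hh₁ : 1 ≤ h₁ ∧ h₁ ≤ n) (hh₂ : 1 ≤ h₂ ∧ h₂ ≤ n) (hk₁ : 1 ≤ k₁ ∧ k₁ ≤ n)
    (hk₂ : 1 ≤ k₂ ∧ k₂ ≤ n) (hk₃ : 1 ≤ k₃ ∧ k₃ ≤ n) (hk₄ : 1 ≤ k₄ ∧ k₄ ≤ n) :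
    chartParam n k (dehomog n k (plRel k h₁ h₂ k₁ k₂ k₃ k₄)) = 0 := by
  unfold plRel
  simp only [map_sub, map_add, map_mul]
  rw [chartParam_dehomog_pCoord k hh₁ hh₂ hk₁, chartParam_dehomog_pCoord k hk₂ hk₃ hk₄, chartParam_dehomog_pCoord k hh₁ hh₂ hk₂,
    chartParam_dehomog_pCoord k hk₁ hk₃ hk₄, chartParam_dehomog_pCoord k hh₁ hh₂ hk₃, chartParam_dehomog_pCoord k hk₁ hk₂ hk₄,
    chartParam_dehomog_pCoord k hh₁ hh₂ hk₄, chartParam_dehomog_pCoord k hk₁ hk₂ hk₃]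
  exact gp_identity k h₁ h₂ k₁ k₂ k₃ k₄

/-- **`C18L166` HOLDS** (ideal reading): `I_{℘,m} ⊆ (𝓕_m)` — every de-homogenised Plücker relation is a `k[x_u]`-combination of the m-primary
ones (via `(𝓕_m) = ker chartParam`, `Prop3_6_1_holds`).
[cite: Hu2025, §3c closing question (C18L166), p.39 l.30–34; Ex. 3.9 p.40 (unrefereed preprint arXiv:2507.21400v1 under adjudication, D-0012/D-0089
— kernel support on OUR typed carriers of row 101; nothing of the source asserted)] -/
theorem C18L166_holds : C18L166 n k := by
  intro hP
  have hker : RingHom.ker (chartParam n k).toRingHom = Ideal.span (primaryFamily n k) := Prop3_6_1_holds k hP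
  unfold IPlChart IPl
  rw [Ideal.map_span, Ideal.span_le]
  rintro _ ⟨F, ⟨h₁, h₂, k₁, k₂, k₃, k₄, hh₁, h12, hh₂, hk₁, k12, k23, k34, hk₄, rfl⟩, rfl⟩
  rw [SetLike.mem_coe, ← hker, RingHom.mem_ker]
  exact chartParam_dehomog_plRel k ⟨hh₁, by omega⟩ ⟨by omega, hh₂⟩ ⟨hk₁, by omega⟩ ⟨by omega, by omega⟩ ⟨by omega, by omega⟩
    ⟨by omega, hk₄⟩

end Literature.AlgebraicGeometry.Hu2025.Statements.S03Pluecker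

end
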